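import Literature.Probability.Percolation.LoopTraversalBound
import Literature.Probability.Percolation.SiteInterfaceStructure
import HarnessLib

/-!
# Many distinct interface loops crossing a shell force many disjoint open arms

Topic: Probability / Percolation. The several-loops form of the multiple-traversal estimate of
M. Aizenman, A. Burchard, Duke Math. J. 99 (1999), Appendix A — in the tree for ONE interface loop
of critical site percolation (`LoopTraversalBound.lean`,
`IsSiteInterfaceLoop.mem_disjointOccurrencePow_of_hasTraversals`) — as needed for the local
finiteness of the scaling limits of the loop ensemble (F. Camia, C. M. Newman, Comm. Math. Phys.
268 (2006), Thm 2 (ii): in any bounded region there are only finitely many loops of diameter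
`> ε`; the lattice input is that many distinct macroscopic cluster interfaces near a point produce
many disjoint monochromatic arms, an event of small probability by the BK inequality):

* `IsSiteInterfaceLoop.exists_traversal_data'` — the data of one traversal of the shell
  `D(x; ρ, R)` by an interface polygon (a strict crossing arc of the levels `q₁ < q₂`, the middle
  dart, the stretch of left sites), as in `LoopTraversalBound.lean` but returning the disc
  conditions `B̄(leftPt, δ) ⊆ U` rather than memberships in components of `U ∖ trace`, so that
  components can be taken in the complement of SEVERAL traces;
* `IsSiteInterfaceLoop.segment_leftPt_pieceMid_disjoint_polyTrace` — for two interface loops of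
  one configuration with disjoint traces, the half side from the left site of a dart of the first
  to the midpoint of its piece misses the trace of the second (a hit would force the same crossed
  edge, hence a common midpoint); `pieceMid_mem_closure_connectedComponentIn_of_family`,
  `leftPt_mem_connectedComponentIn_of_family` — the component bookkeeping off the union of the
  traces of a family with pairwise disjoint traces;
* `mem_disjointOccurrencePow_of_loops` — **if `2j + 2` interface loops of `ω` with pairwise
  disjoint traces each traverse `D(x; ρ, R)`, then `ω ∈ (triArm δ x (q₁ + 9δ) (q₂ - 9δ))^{□ j}`**
  (`0 < q₁`, `ρ ≤ q₁`, `q₁ + 40δ ≤ q₂ ≤ R`): one strict crossing arc per loop, the three-arcs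
  lemma `not_three_arcs_touch`, disjoint left chains.

Distinct traces of interface loops of one configuration are disjoint
(`IsSiteInterfaceLoop.polyTrace_eq_or_disjoint`, `SiteInterfaceStructure.lean`), so the theorem
applies to loops with pairwise distinct traces. Everything is proved; no named facts.

## References

* M. Aizenman, A. Burchard, Duke Math. J. 99 (1999), Appendix A [AizenmanBurchardDuke1999].
* F. Camia, C. M. Newman, Comm. Math. Phys. 268 (2006), Thm 2 (ii) [CamiaNewman2006].
-/

noncomputable section

open Set Metric Complex Filter MeasureTheory
open Literature.Topology.PlaneTopology Literature.Probability.RandomPlanarGeometry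
open scoped unitInterval Topology

namespace Literature.Probability.Percolation

open LatticeModels

/-! ### The midpoint of a dart piece as the midpoint of the crossed edge -/

section TwoLoops

variable {ω : SiteConfig (Site 2)} {f₀ f₁ : HexVertex} {w : hexGraph.Walk f₀ f₀} {w' : hexGraph.Walk f₁ f₁}
  (hw : IsSiteInterfaceLoop ω w) {δ : ℝ} (hδ : 0 < δ)

include hw

/-- **The midpoint of the `m`-th dart piece is the midpoint of the crossed edge of `𝕋`** (the
hexagonal edge and the crossed edge bisect each other, `midpoint_hexCenter_oppFace`). [folklore] -/
theorem IsSiteInterfaceLoop.pieceMid_eq {m : ℕ} (hm : m < w.length) :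
    pieceMid δ w m = (δ : ℂ) * midpoint ℝ (triEmbed (hw.rv m)) (triEmbed (hw.lv m)) := by
  rw [pieceMid, hw.getVert_succ_eq hm, midpoint_hexCenter_oppFace, ← hw.rv_eq hm, ← hw.lv_eq hm]

include hδ

/-- **For two interface loops of one configuration with disjoint traces, the half side from the
left site of a dart of the first to the midpoint of its piece misses the trace of the second**:
a common point would lie on the crossed edge of some step of the second loop
(`eq_lv_rv_of_inter`), which by the colours is the same oriented edge, so the two pieces would
share their midpoint. [folklore] -/
theorem IsSiteInterfaceLoop.segment_leftPt_pieceMid_disjoint_polyTrace (hw' : IsSiteInterfaceLoop ω w')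
    {m : ℕ} (hm : m < w.length) (hdis : Disjoint (polyTrace δ w) (polyTrace δ w')) :
    Disjoint (segment ℝ (hw.leftPt δ m) (pieceMid δ w m)) (polyTrace δ w') := by
  refine disjoint_left.2 fun q hq hqt ↦ ?_
  obtain ⟨i, hi, hqi⟩ := mem_polyTrace_iff.1 hqt
  have hmid : pieceMid δ w m ∈ hw.sideSeg δ m := hw.pieceMid_mem_sideSeg hδ hm
  have hq1 : q ∈ segment ℝ (triMeshPoint δ (hw.lv m)) (triMeshPoint δ (hw.rv m)) :=
    (convex_segment _ _).segment_subset (left_mem_segment _ _ _) hmid hq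
  rcases hw'.eq_lv_rv_of_inter hδ (Or.inr (hw.adj_lv_rv hm)) hi hq1 hqi with ⟨h1, -⟩ | ⟨h1, h2⟩
  · exact hw'.rv_not_mem hi (h1 ▸ hw.lv_mem hm)
  · have e : pieceMid δ w m = pieceMid δ w' i := by
      rw [hw.pieceMid_eq hm, hw'.pieceMid_eq hi, h1, h2]
    exact Set.disjoint_left.1 hdis (polyPiece_subset_polyTrace hm (pieceMid_mem_polyPiece δ w m))
      (e ▸ polyPiece_subset_polyTrace hi (pieceMid_mem_polyPiece δ w' i))

end TwoLoops

/-! ### Components off the union of the traces of a family -/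

section Family

variable {ω : SiteConfig (Site 2)} {δ : ℝ} (hδ : 0 < δ) {ι : Type*} {f : ι → HexVertex}
  {w : ∀ l, hexGraph.Walk (f l) (f l)} (hw : ∀ l, IsSiteInterfaceLoop ω (w l))

include hδ hw

/-- **The midpoint is in the closure of the component of the left point, off all traces.** For a
family of interface loops of `ω` with pairwise disjoint traces: if the closed `δ`-disc about the
left point of the dart `m` of the loop `l` lies in the open set `U`, the midpoint of its `m`-th
piece lies in the closure of the component of that left point in `U` minus the union of all the
traces (the half side minus the midpoint is connected, in `U`, and off every trace:
`not_mem_polyTrace_of_mem_segment_leftPt` for the own trace,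
`segment_leftPt_pieceMid_disjoint_polyTrace` for the others). [folklore] -/
theorem pieceMid_mem_closure_connectedComponentIn_of_family
    (hdis : ∀ l l', l ≠ l' → Disjoint (polyTrace δ (w l)) (polyTrace δ (w l'))) (l : ι) {U : Set ℂ}
    {m : ℕ} (hm : m < (w l).length) (hball : closedBall ((hw l).leftPt δ m) δ ⊆ U) :
    pieceMid δ (w l) m ∈ closure (connectedComponentIn (U \ ⋃ l', polyTrace δ (w l')) ((hw l).leftPt δ m)) := by
  classical
  set P := (hw l).leftPt δ m with hP
  set M := pieceMid δ (w l) m with hM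
  set g : ℝ → ℂ := fun θ => AffineMap.lineMap P M θ with hg
  have hgc : Continuous g := AffineMap.lineMap_continuous
  have hsub : g '' Ico (0 : ℝ) 1 ⊆ U \ ⋃ l', polyTrace δ (w l') := by
    rintro z ⟨θ, ⟨h0, h1⟩, rfl⟩
    have hzseg : g θ ∈ segment ℝ P M := by
      rw [segment_eq_image_lineMap]; exact ⟨θ, ⟨h0, h1.le⟩, rfl⟩
    have hne : g θ ≠ M := by
      intro h
      have h2 : AffineMap.lineMap P M θ = AffineMap.lineMap P M (1 : ℝ) := by
        rw [AffineMap.lineMap_apply_one]; exact h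
      have := AffineMap.lineMap_injective ℝ ((hw l).leftPt_ne_pieceMid hδ hm) h2
      linarith
    refine ⟨hball ?_, fun hz ↦ ?_⟩
    · exact (convex_closedBall _ _).segment_subset (mem_closedBall_self hδ.le)
        (mem_closedBall.2 ((hw l).dist_pieceMid_leftPt_le hδ hm)) hzseg
    · obtain ⟨l', hl'⟩ := mem_iUnion.1 hz
      by_cases hll' : l = l'
      · subst hll'
        exact (hw l).not_mem_polyTrace_of_mem_segment_leftPt hδ hm hzseg hne hl'
      · exact Set.disjoint_left.1 ((hw l).segment_leftPt_pieceMid_disjoint_polyTrace hδ (hw l') hm (hdis l l' hll'))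
          hzseg hl'
  have hconn : IsPreconnected (g '' Ico (0 : ℝ) 1) := isPreconnected_Ico.image _ hgc.continuousOn
  have hPmem : P ∈ g '' Ico (0 : ℝ) 1 := ⟨0, ⟨le_rfl, zero_lt_one⟩, by simp [hg]⟩
  have hS : g '' Ico (0 : ℝ) 1 ⊆ connectedComponentIn (U \ ⋃ l', polyTrace δ (w l')) P :=
    hconn.subset_connectedComponentIn hPmem hsub
  have hMcl : M ∈ closure (g '' Ico (0 : ℝ) 1) := by
    have h1 : M = g 1 := by simp [hg]
    rw [h1]
    refine image_closure_subset_closure_image hgc ⟨1, ?_, rfl⟩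
    rw [closure_Ico zero_ne_one]; exact ⟨zero_le_one, le_rfl⟩
  exact closure_mono hS hMcl

/-- **Left points of a stretch lie in one component, off all traces**: if the `δ`-discs of the
left points of the steps `i₀, …, i₁` of the loop `l` lie in `A`, then in `A` minus the union of the
traces of the family all these left points lie in the component of any one of them (consecutive
ones are joined by a point or an open–open edge of `δ𝕋`, which misses every interface trace,
`segment_disjoint_polyTrace_of_mem`). [folklore] -/
theorem leftPt_mem_connectedComponentIn_of_family (l : ι) {A : Set ℂ} {i₀ i₁ : ℕ} (hi₁ : i₁ < (w l).length)
    (hball : ∀ i, i₀ ≤ i → i ≤ i₁ → closedBall ((hw l).leftPt δ i) δ ⊆ A)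
    {i m : ℕ} (hi₀ : i₀ ≤ i) (hi : i ≤ i₁) (hm₀ : i₀ ≤ m) (hm : m ≤ i₁) :
    (hw l).leftPt δ i ∈ connectedComponentIn (A \ ⋃ l', polyTrace δ (w l')) ((hw l).leftPt δ m) := by
  have hoff : ∀ k, (hw l).leftPt δ k ∉ ⋃ l', polyTrace δ (w l') := fun k hk ↦ by
    obtain ⟨l', hl'⟩ := mem_iUnion.1 hk
    exact (hw l').triMeshPoint_not_mem_polyTrace hδ _ hl'
  have key : ∀ k, i₀ + k ≤ i₁ → connectedComponentIn (A \ ⋃ l', polyTrace δ (w l')) ((hw l).leftPt δ (i₀ + k)) =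
      connectedComponentIn (A \ ⋃ l', polyTrace δ (w l')) ((hw l).leftPt δ i₀) := by
    intro k
    induction k with
    | zero => intro; rfl
    | succ k ih =>
      intro hk
      rw [← ih (by omega), show i₀ + (k + 1) = i₀ + k + 1 by omega]
      refine connectedComponentIn_eq ?_
      have hadj : (hw l).lv (i₀ + k) = (hw l).lv (i₀ + k + 1) ∨ triGraph.Adj ((hw l).lv (i₀ + k)) ((hw l).lv (i₀ + k + 1)) := by
        rcases (hw l).lv_succ_eq_or_adj (i := i₀ + k) (by omega) with h | h
        exacts [Or.inl h.symm, Or.inr h]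
      have hseg : segment ℝ ((hw l).leftPt δ (i₀ + k)) ((hw l).leftPt δ (i₀ + k + 1)) ⊆ A \ ⋃ l', polyTrace δ (w l') := by
        intro z hz
        refine ⟨hball (i₀ + k) (by omega) (by omega) ?_, fun hz' ↦ ?_⟩
        · have h := (hw l).dist_leftPt_succ_le hδ.le (i := i₀ + k) (by omega)
          exact (convex_closedBall _ _).segment_subset (mem_closedBall_self hδ.le)
            (mem_closedBall.2 (by rw [dist_comm]; exact h)) hz
        · obtain ⟨l', hl'⟩ := mem_iUnion.1 hz'
          exact disjoint_left.1 ((hw l').segment_disjoint_polyTrace_of_mem hδ hadj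
            ((hw l).lv_mem (by omega)) ((hw l).lv_mem (by omega))) hz hl'
      have hconn : IsPreconnected (segment ℝ ((hw l).leftPt δ (i₀ + k)) ((hw l).leftPt δ (i₀ + k + 1))) :=
        (convex_segment _ _).isPreconnected
      exact hconn.subset_connectedComponentIn (right_mem_segment _ _ _) hseg (left_mem_segment _ _ _)
  obtain ⟨k, rfl⟩ : ∃ k, i = i₀ + k := ⟨i - i₀, by omega⟩
  obtain ⟨k', rfl⟩ : ∃ k', m = i₀ + k' := ⟨m - i₀, by omega⟩
  have h1 := key k (by omega)
  have h2 := key k' (by omega)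
  have hmem : (hw l).leftPt δ (i₀ + k) ∈ connectedComponentIn (A \ ⋃ l', polyTrace δ (w l')) ((hw l).leftPt δ (i₀ + k)) :=
    mem_connectedComponentIn ⟨hball (i₀ + k) (by omega) (by omega) (mem_closedBall_self hδ.le), hoff _⟩
  rw [h1, ← h2] at hmem
  exact hmem

end Family

/-! ### The data of one traversal (disc form) -/

section OneLoop

variable {ω : SiteConfig (Site 2)} {f₀ : HexVertex} {w : hexGraph.Walk f₀ f₀}
  (hw : IsSiteInterfaceLoop ω w) {δ : ℝ} (hδ : 0 < δ)

include hw hδ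

/-- **The data of one traversal** (the variant of `exists_traversal_data` of
`LoopTraversalBound.lean` returning the disc conditions instead of the component memberships, so
that components may be taken in the complement of several traces). Let the polygon `Γ` of the interface loop traverse
`D(x; ρ, R)` between the times `s ≤ t` with `s > 0`, and let `ρ ≤ q₁`, `q₁ + 40δ ≤ q₂ ≤ R`. Then
there are: a strict crossing `[a, b] ⊆ [s, t]` of the shell `q₁ ≤ |z - x| ≤ q₂` (direction `dir`),
whose times lie in `(0, 1 - 2^{-n}]`; a dart `m` whose piece midpoint lies on `Γ([a, b])`, in the
open annulus `U`, and in the closure of the component `S` of the left point of `m` in `U` minus the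
disc `B̄(leftPt m, δ) ⊆ U`; and a stretch of darts `k₀ ≤ m ≤ k₁` whose left points have their
`δ`-discs in `U`, within `q₂ - 7δ` of `x`, the first within `q₁ + 9δ` and the last beyond
`q₂ - 9δ` (or conversely). [cite: AizenmanBurchardDuke1999, Appendix A] -/
theorem IsSiteInterfaceLoop.exists_traversal_data' {x : ℂ} {ρ R q₁ q₂ : ℝ} (hρq : ρ ≤ q₁)
    (hgap : q₁ + 40 * δ ≤ q₂) (hqR : q₂ ≤ R) {s t : I} (hs0 : 0 < (s : ℝ))
    (htr : (hexLoopCurve δ w).IsTraversal x ρ R s t) :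
    ∃ (a b : I) (dir : Bool) (m k₀ k₁ : ℕ),
      s ≤ a ∧ a < b ∧ b ≤ t ∧
      (∀ v, a ≤ v → v ≤ b → 0 < (v : ℝ) ∧ (v : ℝ) ≤ tailStart w.length) ∧
      (dist (hexLoopCurve δ w a) x = if dir then q₁ else q₂) ∧
      (dist (hexLoopCurve δ w b) x = if dir then q₂ else q₁) ∧
      (∀ v, a < v → v < b → q₁ < dist (hexLoopCurve δ w v) x ∧ dist (hexLoopCurve δ w v) x < q₂) ∧
      m < w.length ∧
      pieceMid δ w m ∈ hexLoopCurve δ w '' {v | a ≤ v ∧ v ≤ b} ∧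
      (q₁ < dist (pieceMid δ w m) x ∧ dist (pieceMid δ w m) x < q₂) ∧
      closedBall (hw.leftPt δ m) δ ⊆ {z | q₁ < dist z x ∧ dist z x < q₂} ∧
      k₀ ≤ k₁ ∧ k₁ < w.length ∧ k₀ ≤ m ∧ m ≤ k₁ ∧
      (∀ k, k₀ ≤ k → k ≤ k₁ → closedBall (hw.leftPt δ k) δ ⊆ {z | q₁ < dist z x ∧ dist z x < q₂}) ∧
      (∀ k, k₀ ≤ k → k ≤ k₁ → dist (hw.leftPt δ k) x ≤ q₂ - 7 * δ) ∧
      ((dist (hw.leftPt δ k₀) x ≤ q₁ + 9 * δ ∧ q₂ - 9 * δ ≤ dist (hw.leftPt δ k₁) x) ∨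
        (q₂ - 9 * δ ≤ dist (hw.leftPt δ k₀) x ∧ dist (hw.leftPt δ k₁) x ≤ q₁ + 9 * δ)) := by
  set Γ := hexLoopCurve δ w with hΓ
  set U : Set ℂ := {z | q₁ < dist z x ∧ dist z x < q₂} with hU
  have hlen : 0 < w.length := by have := hw.three_le_length; omega
  have hq : q₁ < q₂ := by linarith
  -- the outer strict crossing
  obtain ⟨a, b, hsa, hab, hbt, hlev, hstrict⟩ := exists_strict_crossing_of_isTraversal htr hρq hq hqR
  -- its times are in `(0, τ]`
  have htimes : ∀ v, a ≤ v → v ≤ b → 0 < (v : ℝ) ∧ (v : ℝ) ≤ tailStart w.length := by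
    have hbτ : (b : ℝ) ≤ tailStart w.length := by
      by_contra h
      push Not at h
      obtain ⟨v, hav, hvb, hτv⟩ := exists_time_between hab h (tailStart_nonneg _)
      have h1 : Γ v = Γ 1 := toCurve_eq_toCurve_one_of_tailStart_le w hτv
      have h2 : Γ b = Γ 1 := toCurve_eq_toCurve_one_of_tailStart_le w h.le
      have h3 := hstrict v hav hvb
      rw [h1, ← h2] at h3
      rcases hlev with ⟨-, hb⟩ | ⟨-, hb⟩ <;> rw [hb] at h3 <;> linarith [h3.1, h3.2]
    intro v hav hvb
    have hsa' : (s : ℝ) ≤ a := hsa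
    have hav' : (a : ℝ) ≤ v := hav
    have hvb' : (v : ℝ) ≤ b := hvb
    exact ⟨by linarith, hvb'.trans hbτ⟩
  -- the inner strict crossing of the levels `p₁ = q₁ + 8δ`, `p₂ = q₂ - 8δ`
  have htrav' : Γ.IsTraversal x q₁ q₂ a b := by
    refine ⟨hab.le, ?_⟩
    rcases hlev with ⟨ha, hb⟩ | ⟨ha, hb⟩
    · exact Or.inl ⟨ha.le, hb.ge⟩
    · exact Or.inr ⟨ha.ge, hb.le⟩
  obtain ⟨c, d, hac, hcd, hdb, hlev', hstrict'⟩ := exists_strict_crossing_of_isTraversal htrav'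
    (show q₁ ≤ q₁ + 8 * δ by linarith) (show q₁ + 8 * δ < q₂ - 8 * δ by linarith) (show q₂ - 8 * δ ≤ q₂ by linarith)
  have hmid' : ∀ v, c ≤ v → v ≤ d → q₁ + 8 * δ ≤ dist (Γ v) x ∧ dist (Γ v) x ≤ q₂ - 8 * δ := by
    intro v hcv hvd
    rcases eq_or_lt_of_le hcv with h | h
    · subst h
      rcases hlev' with ⟨h1, -⟩ | ⟨h1, -⟩ <;> rw [h1] <;> constructor <;> linarith
    rcases eq_or_lt_of_le hvd with h' | h'
    · subst h'
      rcases hlev' with ⟨-, h1⟩ | ⟨-, h1⟩ <;> rw [h1] <;> constructor <;> linarith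
    exact ⟨(hstrict' v h h').1.le, (hstrict' v h h').2.le⟩
  -- the middle dart and the midpoint on the crossing
  obtain ⟨u, m, hcu, hud, hm, hm1, hm2, hfar1, hfar2⟩ :=
    hw.exists_middle_dart hδ (show q₁ + 8 * δ + 18 * δ ≤ q₂ - 8 * δ by linarith) hcd hlev'
  have hn : m < w.length := by omega
  obtain ⟨u₁, hcu₁, hu₁d, hu₁⟩ := hw.exists_eq_pieceMid hδ hcu hud hlev' hm hm1 hm2 hfar1 hfar2
  -- distances of the left point of `m` and of the midpoint
  have hleft : dist (hw.leftPt δ m) x ≤ dist (Γ u) x + δ ∧ dist (Γ u) x - δ ≤ dist (hw.leftPt δ m) x := by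
    have h := hw.dist_hexLoopCurve_leftPt_le hδ u
    rw [hm] at h
    constructor
    · linarith [dist_triangle (hw.leftPt δ m) (Γ u) x, dist_comm (Γ u) (hw.leftPt δ m)]
    · linarith [dist_triangle (Γ u) (hw.leftPt δ m) x]
  have hMdist : q₁ < dist (pieceMid δ w m) x ∧ dist (pieceMid δ w m) x < q₂ := by
    have h1 := hw.dist_pieceMid_leftPt_le hδ hn
    constructor
    · linarith [dist_triangle (hw.leftPt δ m) (pieceMid δ w m) x, dist_comm (pieceMid δ w m) (hw.leftPt δ m), hleft.2]
    · linarith [dist_triangle (pieceMid δ w m) (hw.leftPt δ m) x, hleft.1]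
  have hballU : closedBall (hw.leftPt δ m) δ ⊆ U := by
    intro z hz
    rw [mem_closedBall] at hz
    constructor
    · linarith [dist_triangle (hw.leftPt δ m) z x, dist_comm z (hw.leftPt δ m), hleft.2]
    · linarith [dist_triangle z (hw.leftPt δ m) x, hleft.1]
  -- the chain
  obtain ⟨hchain, hends⟩ := hw.leftPt_chain hδ hcd.le hlev' hmid'
  have hk₀k₁ : polyIdx w.length c ≤ polyIdx w.length d := polyIdx_mono _ hcd.le
  have hk₁ : polyIdx w.length d < w.length := polyIdx_lt hlen d
  have hmk : polyIdx w.length c ≤ m ∧ m ≤ polyIdx w.length d :=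
    ⟨hm ▸ polyIdx_mono _ hcu.le, hm ▸ polyIdx_mono _ hud.le⟩
  have hballs : ∀ i, polyIdx w.length c ≤ i → i ≤ polyIdx w.length d → closedBall (hw.leftPt δ i) δ ⊆ U := by
    intro i hi1 hi2 z hz
    obtain ⟨h1, h2⟩ := hchain i hi1 hi2
    rw [mem_closedBall] at hz
    constructor
    · linarith [dist_triangle (hw.leftPt δ i) z x, dist_comm z (hw.leftPt δ i)]
    · linarith [dist_triangle z (hw.leftPt δ i) x]
  -- assemble, by cases on the direction of the outer crossing
  have key : ∀ dir : Bool, (dist (Γ a) x = if dir then q₁ else q₂) → (dist (Γ b) x = if dir then q₂ else q₁) →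
      ∃ (a b : I) (dir : Bool) (m k₀ k₁ : ℕ),
      s ≤ a ∧ a < b ∧ b ≤ t ∧
      (∀ v, a ≤ v → v ≤ b → 0 < (v : ℝ) ∧ (v : ℝ) ≤ tailStart w.length) ∧
      (dist (Γ a) x = if dir then q₁ else q₂) ∧ (dist (Γ b) x = if dir then q₂ else q₁) ∧
      (∀ v, a < v → v < b → q₁ < dist (Γ v) x ∧ dist (Γ v) x < q₂) ∧
      m < w.length ∧ pieceMid δ w m ∈ Γ '' {v | a ≤ v ∧ v ≤ b} ∧
      (q₁ < dist (pieceMid δ w m) x ∧ dist (pieceMid δ w m) x < q₂) ∧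
      closedBall (hw.leftPt δ m) δ ⊆ U ∧
      k₀ ≤ k₁ ∧ k₁ < w.length ∧ k₀ ≤ m ∧ m ≤ k₁ ∧
      (∀ k, k₀ ≤ k → k ≤ k₁ → closedBall (hw.leftPt δ k) δ ⊆ U) ∧
      (∀ k, k₀ ≤ k → k ≤ k₁ → dist (hw.leftPt δ k) x ≤ q₂ - 7 * δ) ∧
      ((dist (hw.leftPt δ k₀) x ≤ q₁ + 9 * δ ∧ q₂ - 9 * δ ≤ dist (hw.leftPt δ k₁) x) ∨
        (q₂ - 9 * δ ≤ dist (hw.leftPt δ k₀) x ∧ dist (hw.leftPt δ k₁) x ≤ q₁ + 9 * δ)) := by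
    intro dir ha hb
    refine ⟨a, b, dir, m, polyIdx w.length c, polyIdx w.length d, hsa, hab, hbt, htimes, ha, hb, hstrict, hn,
      ⟨u₁, ⟨hac.trans hcu₁, hu₁d.trans hdb⟩, hu₁⟩, hMdist,
      hballU, hk₀k₁, hk₁, hmk.1, hmk.2, hballs, fun k hk1 hk2 ↦ ?_, ?_⟩
    · linarith [(hchain k hk1 hk2).2]
    · rcases hends with ⟨h1, h2⟩ | ⟨h1, h2⟩
      · left; constructor <;> linarith
      · right; constructor <;> linarith
  rcases hlev with ⟨ha, hb⟩ | ⟨ha, hb⟩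
  · exact key true (by simp [ha]) (by simp [hb])
  · exact key false (by simp [ha]) (by simp [hb])

end OneLoop

/-! ### Many loops force many disjoint open arms -/

/-- **Many interface loops with disjoint traces crossing a shell force many disjoint open arms**
(the several-loops form of Aizenman–Burchard 1999, App. A / `LoopTraversalBound.lean`, used to
control the number of distinct macroscopic cluster interfaces near a point; Camia–Newman 2006,
Thm 2 (ii): only finitely many loops of diameter `> ε` in any bounded region). If `2j + 2`
interface loops of `ω` at mesh `δ` have pairwise disjoint traces and the polygon of each
traverses `D(x; ρ, R)` (from a positive time), and `0 < q₁`, `ρ ≤ q₁`, `q₁ + 40δ ≤ q₂ ≤ R`, then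
`ω ∈ (triArm δ x (q₁ + 9δ) (q₂ - 9δ))^{□ j}`: one strict crossing arc per loop (pairwise
disjoint as the traces are), the components, in the open annulus minus ALL the traces, of the
left hexagons of their middle darts are at most two-to-one (`not_three_arcs_touch`), and the left
chains with distinct components are disjoint open arms. [cite: AizenmanBurchardDuke1999, Appendix A] -/
theorem mem_disjointOccurrencePow_of_loops {ω : SiteConfig (Site 2)} {δ : ℝ} (hδ : 0 < δ) {x : ℂ}
    {ρ R q₁ q₂ : ℝ} (hq₁ : 0 < q₁) (hρq : ρ ≤ q₁) (hgap : q₁ + 40 * δ ≤ q₂) (hqR : q₂ ≤ R) {j : ℕ}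
    {f : Fin (2 * j + 2) → HexVertex} {w : ∀ l, hexGraph.Walk (f l) (f l)}
    (hw : ∀ l, IsSiteInterfaceLoop ω (w l))
    (hdis : ∀ l l', l ≠ l' → Disjoint (polyTrace δ (w l)) (polyTrace δ (w l')))
    (htr : ∀ l, ∃ s t : I, 0 < (s : ℝ) ∧ (hexLoopCurve δ (w l)).IsTraversal x ρ R s t) :
    ω ∈ disjointOccurrencePow (triArm δ x (q₁ + 9 * δ) (q₂ - 9 * δ)) j := by
  classical
  set U : Set ℂ := {z | q₁ < dist z x ∧ dist z x < q₂} with hU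
  set K : Set ℂ := ⋃ l, polyTrace δ (w l) with hK
  have hq : q₁ < q₂ := by linarith
  have hlen : ∀ l, 0 < (w l).length := fun l ↦ by have := (hw l).three_le_length; omega
  choose s t hs0 htrav using htr
  choose a b dir m k₀ k₁ hsa hab hbt htimes hA hB hstrict hmlt hMmem hMU hballU hk₀k₁ hk₁ hk₀m hmk₁ hballs hconf hends using
    fun l : Fin (2 * j + 2) ↦ (hw l).exists_traversal_data' hδ hρq hgap hqR (hs0 l) (htrav l)
  /- the components of the left hexagons of the middle darts, off ALL traces -/
  set comp : Fin (2 * j + 2) → Set ℂ := fun l ↦ connectedComponentIn (U \ K) ((hw l).leftPt δ (m l))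
    with hcompdef
  have hMcl : ∀ l, pieceMid δ (w l) (m l) ∈ closure (comp l) := fun l ↦
    pieceMid_mem_closure_connectedComponentIn_of_family hδ hw hdis l (hmlt l) (hballU l)
  have hcomp : ∀ l k, k₀ l ≤ k → k ≤ k₁ l → (hw l).leftPt δ k ∈ comp l := fun l k hk1 hk2 ↦
    leftPt_mem_connectedComponentIn_of_family hδ hw l (hk₁ l) (hballs l) hk1 hk2 (hk₀m l) (hmk₁ l)
  /- the arcs -/
  set arc : ∀ _ : Fin (2 * j + 2), Σ p : ℂ × ℂ, Path p.1 p.2 :=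
    fun l ↦ orientedArc (hexLoopCurve δ (w l)) (a l) (b l) (hab l).le (dir l) with harc
  have harc1 : ∀ l, (arc l).1 = if dir l then (hexLoopCurve δ (w l) (a l), hexLoopCurve δ (w l) (b l)) else (hexLoopCurve δ (w l) (b l), hexLoopCurve δ (w l) (a l)) :=
    fun l ↦ orientedArc_fst (hexLoopCurve δ (w l)) (hab l).le (dir l)
  have hrange : ∀ l, range (arc l).2 = hexLoopCurve δ (w l) '' {v | a l ≤ v ∧ v ≤ b l} :=
    fun l ↦ range_orientedArc (hexLoopCurve δ (w l)) (hab l).le (dir l)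
  -- points of an arc: distances, and the only points on the circles
  have hpt : ∀ l (v : I), a l ≤ v → v ≤ b l →
      (dist (hexLoopCurve δ (w l) v) x = q₁ → hexLoopCurve δ (w l) v = (arc l).1.1) ∧ (dist (hexLoopCurve δ (w l) v) x = q₂ → hexLoopCurve δ (w l) v = (arc l).1.2) ∧
      q₁ ≤ dist (hexLoopCurve δ (w l) v) x ∧ dist (hexLoopCurve δ (w l) v) x ≤ q₂ := by
    intro l v hav hvb
    have h1 := hA l; have h2 := hB l; have h3 := harc1 l
    cases hd : dir l
    · -- `dir = false`: `Γ a` on the outer circle, `Γ b` on the inner one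
      simp only [hd, Bool.false_eq_true, ↓reduceIte] at h1 h2 h3
      rw [h3]
      rcases eq_or_lt_of_le hav with h | h
      · subst h; exact ⟨fun h' ↦ by rw [h1] at h'; linarith, fun _ ↦ rfl, by rw [h1]; exact hq.le, by rw [h1]⟩
      rcases eq_or_lt_of_le hvb with h' | h'
      · subst h'; exact ⟨fun _ ↦ rfl, fun h'' ↦ by rw [h2] at h''; linarith, by rw [h2], by rw [h2]; exact hq.le⟩
      have := hstrict l v h h'
      exact ⟨fun h'' ↦ by linarith [this.1], fun h'' ↦ by linarith [this.2], this.1.le, this.2.le⟩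
    · -- `dir = true`: `Γ a` on the inner circle, `Γ b` on the outer one
      simp only [hd, ↓reduceIte] at h1 h2 h3
      rw [h3]
      rcases eq_or_lt_of_le hav with h | h
      · subst h; exact ⟨fun _ ↦ rfl, fun h' ↦ by rw [h1] at h'; linarith, by rw [h1], by rw [h1]; exact hq.le⟩
      rcases eq_or_lt_of_le hvb with h' | h'
      · subst h'; exact ⟨fun h'' ↦ by rw [h2] at h''; linarith, fun _ ↦ rfl, by rw [h2]; exact hq.le, by rw [h2]⟩
      have := hstrict l v h h'
      exact ⟨fun h'' ↦ by linarith [this.1], fun h'' ↦ by linarith [this.2], this.1.le, this.2.le⟩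
  have he : ∀ l, dist (arc l).1.1 x = q₁ := by
    intro l; have h1 := hA l; have h2 := hB l; rw [harc1]
    cases hd : dir l
    · simp only [hd, Bool.false_eq_true, ↓reduceIte] at h1 h2 ⊢; exact h2
    · simp only [hd, ↓reduceIte] at h1 h2 ⊢; exact h1
  have hf : ∀ l, dist (arc l).1.2 x = q₂ := by
    intro l; have h1 := hA l; have h2 := hB l; rw [harc1]
    cases hd : dir l
    · simp only [hd, Bool.false_eq_true, ↓reduceIte] at h1 h2 ⊢; exact h1
    · simp only [hd, ↓reduceIte] at h1 h2 ⊢; exact h2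
  have hmemarc : ∀ l (u : I), ∃ v : I, a l ≤ v ∧ v ≤ b l ∧ (arc l).2 u = hexLoopCurve δ (w l) v := by
    intro l u
    have : (arc l).2 u ∈ range (arc l).2 := ⟨u, rfl⟩
    rw [hrange] at this
    obtain ⟨v, ⟨h1, h2⟩, h3⟩ := this
    exact ⟨v, h1, h2, h3.symm⟩
  -- the arcs are pairwise disjoint (the traces are)
  have hdisj : ∀ l l', l ≠ l' → Disjoint (range (arc l).2) (range (arc l').2) := by
    intro l l' hll'
    rw [hrange, hrange]
    refine Set.disjoint_of_subset ?_ ?_ (hdis l l' hll')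
    · rintro _ ⟨v, -, rfl⟩; exact range_toCurve_subset_polyTrace (hlen l) ⟨v, rfl⟩
    · rintro _ ⟨v, -, rfl⟩; exact range_toCurve_subset_polyTrace (hlen l') ⟨v, rfl⟩
  -- the components miss the arcs
  have hcompsub : ∀ l, comp l ⊆ U \ K := fun l ↦ connectedComponentIn_subset _ _
  have hST : ∀ l l', Disjoint (comp l) (range (arc l').2) := by
    intro l l'
    rw [hrange]
    refine disjoint_left.2 ?_
    rintro z hz ⟨v, -, rfl⟩
    exact (hcompsub l hz).2 (mem_iUnion.2 ⟨l', range_toCurve_subset_polyTrace (hlen l') ⟨v, rfl⟩⟩)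
  /- no three components coincide -/
  have hfib : ∀ l₁ l₂ l₃ : Fin (2 * j + 2), l₁ ≠ l₂ → l₂ ≠ l₃ → l₃ ≠ l₁ →
      comp l₁ = comp l₂ → comp l₂ = comp l₃ → False := by
    intro l₁ l₂ l₃ h12 h23 h31 e12 e23
    have htouch : ∀ l, comp l₁ = comp l → (closure (comp l₁) ∩ range (arc l).2 ∩ U).Nonempty := by
      intro l e
      refine ⟨pieceMid δ (w l) (m l), ⟨?_, ?_⟩, hMU l⟩
      · rw [e]; exact hMcl l
      · rw [hrange]; exact hMmem l
    exact not_three_arcs_touch hq₁ hq (fun l ↦ (arc l).2) he hf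
      (fun l u ↦ by obtain ⟨v, h1, h2, h3⟩ := hmemarc l u; rw [h3]; exact ⟨(hpt l v h1 h2).2.2.1, (hpt l v h1 h2).2.2.2⟩)
      (fun l u hu ↦ by obtain ⟨v, h1, h2, h3⟩ := hmemarc l u; rw [h3] at hu ⊢; exact (hpt l v h1 h2).1 hu)
      (fun l u hu ↦ by obtain ⟨v, h1, h2, h3⟩ := hmemarc l u; rw [h3] at hu ⊢; exact (hpt l v h1 h2).2.1 hu)
      hdisj isPreconnected_connectedComponentIn (fun z hz ↦ (hcompsub l₁ hz).1) (hST l₁) h12 h23 h31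
      (htouch l₁ rfl) (htouch l₂ e12) (htouch l₃ (e12.trans e23))
  /- counting: at least `j + 1` distinct components -/
  set F : Finset (Set ℂ) := Finset.univ.image comp with hF
  have hcard : 2 * j + 2 ≤ 2 * F.card := by
    have h := Finset.card_le_mul_card_image (Finset.univ : Finset (Fin (2 * j + 2))) (f := comp) 2 ?_
    · simpa using h
    intro y hy
    by_contra hgt
    push Not at hgt
    obtain ⟨l₁, hl₁, l₂, hl₂, l₃, hl₃, h12, h13, h23⟩ := exists_three_of_two_lt_card hgt
    simp only [Finset.mem_filter, Finset.mem_univ, true_and] at hl₁ hl₂ hl₃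
    exact hfib l₁ l₂ l₃ h12 h23 (Ne.symm h13) (hl₁.trans hl₂.symm) (hl₂.trans hl₃.symm)
  have hjF : j ≤ F.card := by omega
  -- a section of `comp` over `F`, and `j` indices with pairwise distinct components
  have hsec : ∀ y : F, ∃ l, comp l = y := fun y ↦ by
    obtain ⟨l, -, hl⟩ := Finset.mem_image.1 y.2
    exact ⟨l, hl⟩
  choose sec hsec using hsec
  set L : Fin j → Fin (2 * j + 2) := fun i ↦ sec (F.equivFin.symm (Fin.castLE hjF i)) with hL
  have hLne : ∀ i i', i ≠ i' → comp (L i) ≠ comp (L i') := by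
    intro i i' hii' h
    apply hii'
    have h1 : (F.equivFin.symm (Fin.castLE hjF i) : Set ℂ) = F.equivFin.symm (Fin.castLE hjF i') := by
      rw [← hsec, ← hsec]; exact h
    have h2 := F.equivFin.symm.injective (Subtype.ext h1)
    exact Fin.castLE_injective hjF h2
  /- the chains -/
  refine mem_disjointOccurrencePow_triArm_of_chains (fun i ↦ k₁ (L i) - k₀ (L i))
    (fun i p ↦ (hw (L i)).lv (k₀ (L i) + p)) (fun i p hp ↦ ?_) (fun i p hp ↦ ?_) (fun i p hp ↦ ?_) (fun i ↦ ?_) ?_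
  · -- consecutive sites equal or adjacent
    have h := (hw (L i)).lv_succ_eq_or_adj (i := k₀ (L i) + p) (by have := hk₁ (L i); omega)
    rcases h with h | h
    · exact Or.inl h.symm
    · exact Or.inr h
  · -- confinement
    have := hconf (L i) (k₀ (L i) + p) (by omega) (by have := hk₀k₁ (L i); omega)
    change dist ((hw (L i)).leftPt δ (k₀ (L i) + p)) x ≤ _
    linarith
  · -- openness
    exact (hw (L i)).lv_mem (by have := hk₁ (L i); have := hk₀k₁ (L i); omega)
  · -- ends
    have e : k₀ (L i) + (k₁ (L i) - k₀ (L i)) = k₁ (L i) := by have := hk₀k₁ (L i); omega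
    change (dist ((hw (L i)).leftPt δ (k₀ (L i) + 0)) x ≤ _ ∧ _ ≤ dist ((hw (L i)).leftPt δ (k₀ (L i) + (k₁ (L i) - k₀ (L i)))) x) ∨
      (_ ≤ dist ((hw (L i)).leftPt δ (k₀ (L i) + 0)) x ∧ dist ((hw (L i)).leftPt δ (k₀ (L i) + (k₁ (L i) - k₀ (L i)))) x ≤ _)
    rw [add_zero, e]
    exact hends (L i)
  · -- disjointness from distinct components
    intro i i' hii' p p' hp hp' heq
    apply hLne i i' hii'
    have h1 := hcomp (L i) (k₀ (L i) + p) (by omega) (by have := hk₀k₁ (L i); omega)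
    have h2 := hcomp (L i') (k₀ (L i') + p') (by omega) (by have := hk₀k₁ (L i'); omega)
    have hpt_eq : (hw (L i)).leftPt δ (k₀ (L i) + p) = (hw (L i')).leftPt δ (k₀ (L i') + p') := by
      change triMeshPoint δ ((hw (L i)).lv (k₀ (L i) + p)) = triMeshPoint δ ((hw (L i')).lv (k₀ (L i') + p'))
      rw [heq]
    change connectedComponentIn (U \ K) ((hw (L i)).leftPt δ (m (L i))) =
      connectedComponentIn (U \ K) ((hw (L i')).leftPt δ (m (L i')))
    rw [connectedComponentIn_eq h1, connectedComponentIn_eq h2, hpt_eq]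

end Literature.Probability.Percolation
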